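import Summits.CriticalPhenomena.Ising3D.TaylorTableCertB3Defs
import Summits.CriticalPhenomena.Ising3D.TaylorTableIdentityCLeaf
import HarnessLib

/-!
# γ-box certificate data of the cand C (slaved-Psi mg4, c 0.0026; BOX 3) functional, II: the IDENTITY obligation in the kernel (ONE centred-form leaf, theorem)
(cell `pub-ising3x`, seat boot-1 gen 17/18; gate (g2); namespace `CertB3I`; continues `TaylorTableCertB3Defs` — generated by gen_table.py `--what identityC`)

HONEST FRAMING: lottery ticket; floor = tightest certified 3D Ising CFT bounds; no exact-solution
claim without a proof. Island framing: certified exclusion region at stated derivative order and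
assumptions; not a determination of the 3D Ising critical exponents beyond that.

`tI_check`: the one-leaf certificate `CertB3.tI` passes with the centred-form leaf check `identityLeafC` (one `decide +kernel`, ≈ 20 s);
**`B3_identity_pos`**: obligation (I) `0 < identityTerm` of the cand C (slaved-Psi mg4, c 0.0026; BOX 3) functional on the whole box, by `identity_pos_of_kdCheckC`. [folklore]
-/

set_option linter.style.longLine false

namespace Summit.CriticalPhenomena.Ising3D
namespace CertB3I
open Set Literature.MathematicalPhysics.QuantumFieldTheory.ConformalBootstrap3D Literature.Analysis.ValidatedNumerics

/-- The identity check box `[(σlo, σhi), (εlo, εhi), (κ.lo, κ.hi)]`. [folklore] -/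
def box3 : Box := [(((33957 : ℚ) / 65536), ((16979 : ℚ) / 32768)), (((91357 : ℚ) / 65536), ((45679 : ℚ) / 32768)), (((1256512079841977975 : ℚ) / 2305843009213693952), ((2513077318681587901 : ℚ) / 4611686018427387904))]

set_option maxHeartbeats 0 in
/-- **The one-leaf centred-form identity certificate passes on the whole box.** [folklore] -/
theorem tI_check : CertB3.tI.check (identityLeafC CertB3.c CertB3.L) box3 = true := by
  decide +kernel

set_option maxHeartbeats 0 in
/-- **The identity obligation (I) of the cand C (slaved-Psi mg4, c 0.0026; BOX 3) functional holds on the box** (kernel, centred-form leaf check). [cite: KosPolandSimmonsduffin2014, §3.2 eq. (3.15)] -/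
theorem B3_identity_pos :
    ∀ p ∈ Icc ((((33957 : ℚ) / 65536) : ℚ) : ℝ) ((((16979 : ℚ) / 32768) : ℚ) : ℝ) ×ˢ Icc ((((91357 : ℚ) / 65536) : ℚ) : ℝ) ((((45679 : ℚ) / 32768) : ℚ) : ℝ),
      0 < (taylorCrossing (1 / 2) (1 / 2) CertB3.L.toFinset (fun i ab => (CertB3.c i ab : ℝ))).identityTerm p.1 p.2 :=
  identity_pos_of_kdCheckC CertB3.c (L := CertB3.L) (by decide +kernel)
    (r₁ := ((57399 : ℚ) / 65536)) (r₂ := ((57401 : ℚ) / 65536)) (klo := ((1256512079841977975 : ℚ) / 2305843009213693952)) (khi := ((2513077318681587901 : ℚ) / 4611686018427387904))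
    (by norm_num) (by norm_num) (by norm_num)
    (by decide +kernel) (by decide +kernel) (t := CertB3.tI) (by simpa only [box3] using tI_check)

end CertB3I
end Summit.CriticalPhenomena.Ising3D
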